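import Summits.RiemannHypothesis.RiemannHypothesis.Theorems.WeilFormatCTailMajorant
import Summits.RiemannHypothesis.RiemannHypothesis.Theorems.WeilFormatCSoundness
import Summits.RiemannHypothesis.RiemannHypothesis.Theorems.WeilFormatCFarDiagPos
import Summits.RiemannHypothesis.RiemannHypothesis.Theorems.WeilFormatCSectorKernels
import Summits.RiemannHypothesis.RiemannHypothesis.Theorems.WeilFormatCEntrySesq
import Summits.RiemannHypothesis.RiemannHypothesis.Theorems.WeilFormatCCertificate
import Summits.RiemannHypothesis.RiemannHypothesis.Theorems.WeilFormatCDataRung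
import HarnessLib

/-!
# Format C: the GENERIC data front door — exact columns + ANY certified tail matrix ⟹ `WeilPositivityOn a`

Route context: Fourier–Galerkin / Schur-complement certificates of Weil positivity on a window ("format C";
cell memo `run/shared/lean/pub/rh-explicit/rh-explicit-weil-10/FORMATC-DESIGN.md` §9.9; supporting
stmt-RiemannHypothesis-0098; seat rh-explicit-weil-10).  This is `WeilFormatC.weilPositivityOn_of_formatC_dataJ` with the
tail majorant ABSTRACTED: instead of the explicit order-`J` tail matrix the theorem takes, per sector, a matrix `U₂` and
the majorant premise

  `hU2 : ∀ d, (∀ m ≥ B₃, d₀ ≤ d m) → ∀ N x, Σ_{m∈Ico B₃ N} (Σ_i M(i,m)x_i)²/d m ≤ xᵀU₂x`,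

which is LITERALLY the conclusion shape of every tail theorem of the chain (`even/odd_tailJ_majorant_matrix` — order `J`,
`C_A²` bound; `even/odd_tailJMS_majorant_matrix` — order `J`, mean-square bound; any later lever), so that a rung's
certificate is `weilPositivityOn_of_formatC_kernels ha … (fun d hd N x ↦ even_tailJMS_majorant_matrix ha … d hd0 hd … N x) hSe
… (fun d hd N x ↦ odd_tailJMS_majorant_matrix …) hSo` with the kernel PSD checks `hSe`, `hSo` stated against the chosen
`U₂⁺`, `U₂⁻`.  Everything else (sector kernels `M⁺ = [i=0: G(0,m) | (G(i,m)+G(i,−m))/2]`,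
`M⁻(k,l) = (G(k+1,l+1) − G(k+1,−(l+1)))/2`, `G = gramCoeff a`, far diagonals `d̂⁺`, `d̂⁻` (odd: arctan weights), column
weights, the positivity facts at `B` and `B₃`) is as in the order-`J` door.

* `weilPositivityOn_of_formatC_kernels` — the generic door.

Standard axioms; no definitions; no RH claim (a rung `WeilPositivityOn a` is one case of
`riemannHypothesis_iff_forall_weilPositivityOn`).
-/

set_option autoImplicit false
-- `Summit.RiemannHypothesis.RiemannHypothesis.…` is the layout-mandated namespace (summit = problem name).
set_option linter.dupNamespace false

noncomputable section

open Complex Finset Matrix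
open scoped Real BigOperators ArithmeticFunction.vonMangoldt

namespace Summit.RiemannHypothesis.RiemannHypothesis.Theorems.WeilFormatC

open Literature.NumberTheory.LFunctions Literature.NumberTheory.LFunctions.Yoshida1992
open Literature.Analysis.SpecialFunctions

variable {a : ℝ}

/-! ## The data-only rung theorem -/

section Rung

/-- **Format C, generic data front door.**  See the module docstring: per sector, exact columns on `[B, B₃)` with
weights `w`, an ARBITRARY tail matrix `U₂` certified by the majorant premise `hU2`, and the kernel PSD check against
`M − U₁ − U₂`; the conclusion is the rung `WeilPositivityOn a`.  (Even block: modes `0..B⁺−1`; odd block: kernel indices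
`0..B⁻−1` = modes `1..B⁻`.) -/
theorem weilPositivityOn_of_formatC_kernels (ha : 0 < a)
    -- EVEN sector data
    {Be B3e : ℕ} (hBe : 2 ≤ Be) (hBBe : Be ≤ B3e) {d0e : ℝ}
    (we : ℕ → ℝ)
    (h0e : 0 < ((reDigammaQuarter (freq a Be) - Real.log π) / 2 - a * (1 + weilArchDensity (2 * a)) / (π ^ 2 * Be ^ 2) - 1 / (8 * Be) - a * (1 + weilArchDensity (2 * a)) / π ^ 2 * Real.sqrt (8 / ((Be - 1 : ℕ) : ℝ)) - (∑ k ∈ weilPrimeIndex a, (Λ k : ℝ) / Real.sqrt k * (2 * Real.cos (π / (⌊2 * a / Real.log k⌋₊ + 2)))) / 2))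
    (hd0e : 0 < d0e ∧ d0e ≤ ((reDigammaQuarter (freq a B3e) - Real.log π) / 2 - a * (1 + weilArchDensity (2 * a)) / (π ^ 2 * B3e ^ 2) - 1 / (8 * B3e) - a * (1 + weilArchDensity (2 * a)) / π ^ 2 * Real.sqrt (8 / ((Be - 1 : ℕ) : ℝ)) - (∑ k ∈ weilPrimeIndex a, (Λ k : ℝ) / Real.sqrt k * (2 * Real.cos (π / (⌊2 * a / Real.log k⌋₊ + 2)))) / 2))
    (hwe : ∀ m, Be ≤ m → m < B3e → 0 < we m ∧ we m ≤ ((reDigammaQuarter (freq a m) - Real.log π) / 2 - a * (1 + weilArchDensity (2 * a)) / (π ^ 2 * m ^ 2) - 1 / (8 * m) - a * (1 + weilArchDensity (2 * a)) / π ^ 2 * Real.sqrt (8 / ((Be - 1 : ℕ) : ℝ)) - (∑ k ∈ weilPrimeIndex a, (Λ k : ℝ) / Real.sqrt k * (2 * Real.cos (π / (⌊2 * a / Real.log k⌋₊ + 2)))) / 2))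
    (U2e : Matrix (Fin Be) (Fin Be) ℝ)
    (hU2e : ∀ d : ℕ → ℝ, (∀ m, B3e ≤ m → d0e ≤ d m) → ∀ (N : ℕ) (x : Fin Be → ℝ),
      ∑ m ∈ Finset.Ico B3e N, (∑ i : Fin Be, (if (i : ℕ) = 0 then gramCoeff a 0 m else if m = 0 then gramCoeff a i 0 else (gramCoeff a i m + gramCoeff a i (-(m : ℤ))) / 2) * x i) ^ 2 / d m
        ≤ x ⬝ᵥ U2e *ᵥ x)
    (hSe : ∀ x : Fin Be → ℝ, 0 ≤ ∑ i, ∑ i', x i * x i' *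
      ((if (i : ℕ) = 0 then gramCoeff a 0 i' else if (i' : ℕ) = 0 then gramCoeff a i 0 else (gramCoeff a i i' + gramCoeff a i (-(i' : ℤ))) / 2)
        - (∑ m ∈ Finset.Ico Be B3e, (if (i : ℕ) = 0 then gramCoeff a 0 m else if m = 0 then gramCoeff a i 0 else (gramCoeff a i m + gramCoeff a i (-(m : ℤ))) / 2) * (if (i' : ℕ) = 0 then gramCoeff a 0 m else if m = 0 then gramCoeff a i' 0 else (gramCoeff a i' m + gramCoeff a i' (-(m : ℤ))) / 2) / we m)
        - U2e i i'))
    -- ODD sector data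
    {Bo B3o : ℕ} (hBo : 1 ≤ Bo) (hBBo : Bo ≤ B3o) {d0o : ℝ}
    (wo : ℕ → ℝ)
    (h0o : 0 < ((reDigammaQuarter (freq a ((Bo : ℤ) + 1)) - Real.log π) / 2 - 1 / (8 * ((Bo : ℝ) + 1)) - a * (1 + weilArchDensity (2 * a)) / (π ^ 2 * ((Bo : ℝ) + 1) ^ 2)) - π / 4 - a * (1 + weilArchDensity (2 * a)) / π ^ 2 * Real.sqrt (8 / Bo) - (∑ k ∈ weilPrimeIndex a, (Λ k : ℝ) / Real.sqrt k * (2 * Real.cos (π / (⌊2 * a / Real.log k⌋₊ + 2)))) / 2 - (Real.exp (a / 2) - Real.exp (-(a / 2))) ^ 2 * a / (π ^ 2 * Bo))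
    (hd0o : 0 < d0o ∧ d0o ≤ ((reDigammaQuarter (freq a ((B3o : ℤ) + 1)) - Real.log π) / 2 - 1 / (8 * ((B3o : ℝ) + 1)) - a * (1 + weilArchDensity (2 * a)) / (π ^ 2 * ((B3o : ℝ) + 1) ^ 2)) - π / 4 - a * (1 + weilArchDensity (2 * a)) / π ^ 2 * Real.sqrt (8 / Bo) - (∑ k ∈ weilPrimeIndex a, (Λ k : ℝ) / Real.sqrt k * (2 * Real.cos (π / (⌊2 * a / Real.log k⌋₊ + 2)))) / 2 - (Real.exp (a / 2) - Real.exp (-(a / 2))) ^ 2 * a / (π ^ 2 * Bo))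
    (hwo : ∀ l, Bo ≤ l → l < B3o → 0 < wo l ∧ wo l ≤ ((reDigammaQuarter (freq a ((l : ℤ) + 1)) - Real.log π) / 2 - 1 / (8 * ((l : ℝ) + 1)) - a * (1 + weilArchDensity (2 * a)) / (π ^ 2 * ((l : ℝ) + 1) ^ 2) - (π / 2 - Real.arctan (Real.sqrt Bo / Real.sqrt ((l : ℝ) + 1))) / 2 - a * (1 + weilArchDensity (2 * a)) / π ^ 2 * Real.sqrt (8 / Bo) - (∑ k ∈ weilPrimeIndex a, (Λ k : ℝ) / Real.sqrt k * (2 * Real.cos (π / (⌊2 * a / Real.log k⌋₊ + 2)))) / 2 - (Real.exp (a / 2) - Real.exp (-(a / 2))) ^ 2 * a / (π ^ 2 * Bo)))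
    (U2o : Matrix (Fin Bo) (Fin Bo) ℝ)
    (hU2o : ∀ d : ℕ → ℝ, (∀ l, B3o ≤ l → d0o ≤ d l) → ∀ (N : ℕ) (x : Fin Bo → ℝ),
      ∑ l ∈ Finset.Ico B3o N, (∑ k : Fin Bo, ((gramCoeff a (((k : ℕ) : ℤ) + 1) ((l : ℤ) + 1) - gramCoeff a (((k : ℕ) : ℤ) + 1) (-((l : ℤ) + 1))) / 2) * x k) ^ 2 / d l
        ≤ x ⬝ᵥ U2o *ᵥ x)
    (hSo : ∀ x : Fin Bo → ℝ, 0 ≤ ∑ k, ∑ k', x k * x k' *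
      (((gramCoeff a (((k : ℕ) : ℤ) + 1) (((k' : ℕ) : ℤ) + 1) - gramCoeff a (((k : ℕ) : ℤ) + 1) (-(((k' : ℕ) : ℤ) + 1))) / 2)
        - (∑ l ∈ Finset.Ico Bo B3o, ((gramCoeff a (((k : ℕ) : ℤ) + 1) ((l : ℤ) + 1) - gramCoeff a (((k : ℕ) : ℤ) + 1) (-((l : ℤ) + 1))) / 2) * ((gramCoeff a (((k' : ℕ) : ℤ) + 1) ((l : ℤ) + 1) - gramCoeff a (((k' : ℕ) : ℤ) + 1) (-((l : ℤ) + 1))) / 2) / wo l)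
        - U2o k k')) :
    WeilPositivityOn a := by
  have hE0 : 0 < weilArchDensity (2 * a) := weilArchDensity_pos (by positivity)
  have hC : 0 ≤ a * (1 + weilArchDensity (2 * a)) := by positivity
  -- the sector kernels and far diagonals as functions
  set Mev : ℕ → ℕ → ℝ := fun i j ↦ (if i = 0 then gramCoeff a 0 j else if j = 0 then gramCoeff a i 0 else (gramCoeff a i j + gramCoeff a i (-(j : ℤ))) / 2) with hMev
  set Mod : ℕ → ℕ → ℝ := fun k l ↦ ((gramCoeff a ((k : ℤ) + 1) ((l : ℤ) + 1) - gramCoeff a ((k : ℤ) + 1) (-((l : ℤ) + 1))) / 2) with hMod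
  set dev : ℕ → ℝ := fun m ↦ ((reDigammaQuarter (freq a m) - Real.log π) / 2 - a * (1 + weilArchDensity (2 * a)) / (π ^ 2 * m ^ 2) - 1 / (8 * m) - a * (1 + weilArchDensity (2 * a)) / π ^ 2 * Real.sqrt (8 / ((Be - 1 : ℕ) : ℝ)) - (∑ k ∈ weilPrimeIndex a, (Λ k : ℝ) / Real.sqrt k * (2 * Real.cos (π / (⌊2 * a / Real.log k⌋₊ + 2)))) / 2) with hdev
  set dod : ℕ → ℝ := fun l ↦ ((reDigammaQuarter (freq a ((l : ℤ) + 1)) - Real.log π) / 2 - 1 / (8 * ((l : ℝ) + 1)) - a * (1 + weilArchDensity (2 * a)) / (π ^ 2 * ((l : ℝ) + 1) ^ 2) - (π / 2 - Real.arctan (Real.sqrt Bo / Real.sqrt ((l : ℝ) + 1))) / 2 - a * (1 + weilArchDensity (2 * a)) / π ^ 2 * Real.sqrt (8 / Bo) - (∑ k ∈ weilPrimeIndex a, (Λ k : ℝ) / Real.sqrt k * (2 * Real.cos (π / (⌊2 * a / Real.log k⌋₊ + 2)))) / 2 - (Real.exp (a / 2) - Real.exp (-(a / 2))) ^ 2 *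 a / (π ^ 2 * Bo)) with hdod
  refine weilPositivityOn_of_sector_kernels_nonneg ha (gramCoeff a) (weilWindowSesq_chi ha) (gramCoeff_neg_neg a)
    ?_ ?_
  · -- EVEN sector
    intro K y
    have hB3e1 : 1 ≤ B3e := by omega
    have hd : ∀ m, Be ≤ m → 0 < dev m := fun m hm ↦ by
      simp only [hdev]
      exact even_dhat_pos_of_pos_at ha hBe h0e m hm
    have hdmono : ∀ m, B3e ≤ m → d0e ≤ dev m := fun m hm ↦ by
      simp only [hdev]
      have h := even_dhat_core_mono ha hC hB3e1 hm
      linarith [hd0e.2]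
    have hfar : ∀ (N : ℕ) (y : ℕ → ℝ),
        ∑ n ∈ Finset.Ico Be N, dev n * y n ^ 2 ≤ ∑ n ∈ Finset.Ico Be N, ∑ m ∈ Finset.Ico Be N, y n * Mev n m * y m :=
      fun N y ↦ by
        simp only [hdev, hMev]
        exact gramCoeff_even_far_ge_diag ha hBe N y
    have hU1 : ∀ x : Fin Be → ℝ,
        ∑ m ∈ Finset.Ico Be B3e, (∑ i : Fin Be, Mev i m * x i) ^ 2 / dev m
          ≤ x ⬝ᵥ (Matrix.of fun i j : Fin Be ↦ ∑ m ∈ Finset.Ico Be B3e, Mev i m * Mev j m / we m) *ᵥ x :=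
      fun x ↦ columns_majorant (Finset.Ico Be B3e) (fun m i ↦ Mev i m) dev we
        (fun m hm ↦ by
          have hm := Finset.mem_Ico.mp hm
          have h := hwe m hm.1 hm.2
          simp only [hdev]
          exact h) x
    have hU2 := fun (N : ℕ) (x : Fin Be → ℝ) ↦ hU2e dev hdmono N x
    have key := sum_range_mul_mul_nonneg_of_certificate_sum_split Mev
      (fun n m ↦ evenKernel_symm (gramCoeff a) (gramCoeff_comm a) (gramCoeff_neg_neg a) n m)
      Be B3e hBBe dev _ _ hd hfar hU1 (fun N x ↦ by
        have h := hU2 N x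
        simp only [hMev, hdev] at h ⊢
        exact h) (fun x ↦ by
        have h := hSe x
        simp only [hMev, Matrix.of_apply] at h ⊢
        exact h) K y
    simpa only [hMev] using key
  · -- ODD sector
    intro K z
    have hB3o : 1 ≤ B3o := by omega
    have hd : ∀ l, Bo ≤ l → 0 < dod l := fun l hl ↦ by
      simp only [hdod]
      exact odd_dhat_atan_pos_of_pos_at ha h0o l hl
    have hdlow : ∀ l, B3o ≤ l → d0o ≤ dod l := fun l hl ↦ by
      simp only [hdod]
      have h := odd_dhat_core_mono ha hC hl
      have hpen := hilbert_atan_penalty_le Bo l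
      linarith [hd0o.2]
    have hfar : ∀ (N : ℕ) (z : ℕ → ℝ),
        ∑ k ∈ Finset.Ico Bo N, dod k * z k ^ 2 ≤ ∑ k ∈ Finset.Ico Bo N, ∑ l ∈ Finset.Ico Bo N, z k * Mod k l * z l :=
      fun N z ↦ by
        simp only [hdod, hMod]
        exact gramCoeff_odd_far_ge_diag_atan ha hBo N z
    have hU1 : ∀ x : Fin Bo → ℝ,
        ∑ l ∈ Finset.Ico Bo B3o, (∑ k : Fin Bo, Mod k l * x k) ^ 2 / dod l
          ≤ x ⬝ᵥ (Matrix.of fun k k' : Fin Bo ↦ ∑ l ∈ Finset.Ico Bo B3o, Mod k l * Mod k' l / wo l) *ᵥ x :=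
      fun x ↦ columns_majorant (Finset.Ico Bo B3o) (fun l k ↦ Mod k l) dod wo
        (fun l hl ↦ by
          have hl := Finset.mem_Ico.mp hl
          have h := hwo l hl.1 hl.2
          simp only [hdod]
          exact h) x
    have hU2 := fun (N : ℕ) (x : Fin Bo → ℝ) ↦ hU2o dod hdlow N x
    have key := sum_range_mul_mul_nonneg_of_certificate_sum_split Mod
      (fun k l ↦ oddKernel_symm (gramCoeff a) (gramCoeff_comm a) (gramCoeff_neg_neg a) k l)
      Bo B3o hBBo dod _ _ hd hfar hU1 (fun N x ↦ by
        have h := hU2 N x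
        simp only [hMod, hdod] at h ⊢
        exact h) (fun x ↦ by
        have h := hSo x
        simp only [hMod, Matrix.of_apply] at h ⊢
        exact h) K z
    simpa only [hMod] using key

end Rung

end Summit.RiemannHypothesis.RiemannHypothesis.Theorems.WeilFormatC

end
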